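import Literature.IUT.HodgeArakelov.CohomologyLimitKummerTorsion
import Literature.IUT.HodgeArakelov.TemperedThetaMonoidsProofs

/-!
# [IUTchII] Cor 1.12 / Cor 3.5: the junction hypothesis `htors` / `hμ` ("`M^μ_TM ⊆ M^×_TM`": torsion classes are
# units of the constant monoid) DISCHARGED at the Kummer model of the cohomology limit — proof-only glue over
# abc-iut-w5-d098's `CohomologyLimitKummerTorsion.lean` and abc-iut-w4-d007's `CohomologyLimitKummer.lean`

S. Mochizuki, *Inter-universal Teichmüller theory II*, kurims Dec-2020 manuscript: Cor 1.12 p. 56 ("`M^μ_TM(−) ⊆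
M^×_TM(−)` denotes the submodule of torsion elements"), Prop 3.1 (ii) p. 88 ("`Ψ_cns(M^Θ_*) := M_TM(M^Θ_*)`"),
Cor 3.5 (ii) p. 95 ("up to multiplication by an element of the `N`-torsion subgroup of `Ψ^×_cns`")
[cite: Mochizuki2012, Prop 3.1 (ii) p.88]; classically: the torsion of `lim_{k′} H¹(G_{k′}, Ẑ(1)) = lim (k′ˣ)^∧`
consists of the Kummer classes of the roots of unity `μ(k̄) ⊆ 𝒪^×_{k̄}` [cite: NeukirchSchmidtWingberg2008, II §7].
Claim key DISPUTED (D-0012). PROOF-ONLY companion (abc-iut cell, layer L6, seat abc-iut-w4-d004 gen 2; node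
IUTchII:Cor3.5(ii) — the binder `htors` of `…SyncInftyTorsionProofs` / `…CohomologyModelProofs2` /
`…RecordOrbitProofs.horb_toRecord`; same shape as the binder `hμ` of the Cor 1.12 files, cf. GAP-LEDGER
G-w4d043-1 closed by p419249 + p421726 for `EtaleLevels`). NO definition, NO `Prop` fact.

For ANY theta-environment record `E : ThetaEnvData` whose ambient module is identified (`ψ`, a multiplicative
isomorphism) with the genuine limit `lim_K H¹(N ⊓ K, A')` and whose constant monoid `Ψ_cns` is the image of a
submonoid `O` ("`𝒪^▷_{k̄}`") of the discrete module `A` ("`k̄ˣ`") under abc-iut-w4-d007's Kummer map INTO the limit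
(`h1LimKummer`, read through `ψ`), with bijective cyclotome coefficients `c` (the cyclotomic rigidity isomorphism,
a datum) and `O` containing the torsion of `A` together with inverses (roots of unity are units of `𝒪`, L4
`mem_unitSubmonoid_of_pow_eq_one` at the MLF model): **every torsion element of `E.H` lies in `M^×_TM = E.units`**
(`units_of_isOfFinOrder_ofKummerModel`) — by abc-iut-w5-d098's `exists_h1LimKummer_eq_of_isOfFinAddOrder` and
the record's axiom `units_eq`. Nothing here asserts a disputed claim or takes a side on [IUTchIII] Cor 3.12;
typed ≠ proved ≠ endorsed.
-/

namespace Literature.IUT.HodgeArakelov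

namespace BadPrimeGaussianMonoids

open Literature.AnabelianGeometry.EtaleTheta CohomologySystemOfContH1 TemperedThetaMonoids

universe u v

variable {Q : Type u} [Group Q] (E : TemperedThetaMonoids.ThetaEnvData.{u, v} Q)
  {P : TopGroup.{0}} {G' : Type} [Group G'] [TopologicalSpace G'] [IsTopologicalGroup G']
  (φ : P →* G') (A' : Subgroup G') [A'.Normal] [IsMulCommutative A'] (N : Subgroup P)
  {A : Type} [CommGroup A] [MulDistribMulAction P A] [TopologicalSpace A] [RootableBy A ℕ]
  (c : CyclotomeCoefficients φ A' A) (hA : ∀ b : A, IsOpen (MulAction.stabilizer P b : Set P))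
  (hfi : ∀ b : A, (MulAction.stabilizer P b).FiniteIndex)
  (ψ : E.H ≃* Multiplicative (h1Lim φ A' N ⊥)) (O : Submonoid A) (κO : O →* E.H)

/-- **`M^μ_TM ⊆ M^×_TM` at the Kummer model**: if the ambient module of `E` is the genuine cohomology limit (`ψ`),
the constant monoid is the Kummer image of `O ⊆ A` (`hκO`, `hcns`), the cyclotome coefficients are bijective
(`hc`) and `O` contains every torsion element of `A` and its inverse (`hO`), then EVERY torsion element of `E.H`
is a unit of the constant monoid — the hypothesis `htors`/`hμ` of the Cor 1.12 / Cor 3.5 files HOLDS.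
[cite: NeukirchSchmidtWingberg2008, II §7] -/
theorem units_of_isOfFinOrder_ofKummerModel
    (hκO : ∀ m : O, ψ (κO m) = h1LimKummer φ A' N c hA hfi (m : A))
    (hcns : E.constantMonoid = MonoidHom.mrange κO) (hc : Function.Bijective c.hom)
    (hO : ∀ a : A, IsOfFinOrder a → a ∈ O ∧ a⁻¹ ∈ O) (x : E.H) (hx : IsOfFinOrder x) : x ∈ E.units := by
  -- the class `ψ x` is torsion, hence the Kummer class of a root of unity `u`
  have hψx : IsOfFinAddOrder (Multiplicative.toAdd (ψ x)) :=
    (isOfFinOrder_ofAdd_iff (x := Multiplicative.toAdd (ψ x))).mp (ψ.toMonoidHom.isOfFinOrder hx)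
  obtain ⟨u, hu, hux⟩ := exists_h1LimKummer_eq_of_isOfFinAddOrder φ A' N c hA hfi hc _ hψx
  obtain ⟨huO, huO'⟩ := hO u hu
  -- `x = κO u` and `x⁻¹ = κO u⁻¹`
  have hxu : x = κO ⟨u, huO⟩ := ψ.injective (by rw [hκO, hux]; rfl)
  have hxu' : x⁻¹ = κO ⟨u⁻¹, huO'⟩ := by
    rw [hxu, eq_comm, ← mul_eq_one_iff_eq_inv, ← map_mul]
    have h1 : (⟨u⁻¹, huO'⟩ * ⟨u, huO⟩ : O) = 1 := Subtype.ext (inv_mul_cancel u)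
    rw [h1, map_one]
  -- both lie in `Ψ_cns = mrange κO`, so `x ∈ M^×_TM` by `units_eq`
  rw [E.units_eq x]
  refine ⟨?_, ?_⟩
  · change x ∈ E.constantMonoid
    rw [hcns, hxu]
    exact ⟨_, rfl⟩
  · change x⁻¹ ∈ E.constantMonoid
    rw [hcns, hxu']
    exact ⟨_, rfl⟩

/-- The same in the binder shape used by the Cor 3.5 (ii) files (`htors : ∀ u, IsOfFinOrder u → u ∈ E.units`).
[cite: Mochizuki2012, Prop 3.1 (ii) p.88] -/
theorem htors_ofKummerModel
    (hκO : ∀ m : O, ψ (κO m) = h1LimKummer φ A' N c hA hfi (m : A))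
    (hcns : E.constantMonoid = MonoidHom.mrange κO) (hc : Function.Bijective c.hom)
    (hO : ∀ a : A, IsOfFinOrder a → a ∈ O ∧ a⁻¹ ∈ O) : ∀ x : E.H, IsOfFinOrder x → x ∈ E.units :=
  fun x hx => units_of_isOfFinOrder_ofKummerModel E φ A' N c hA hfi ψ O κO hκO hcns hc hO x hx

end BadPrimeGaussianMonoids

end Literature.IUT.HodgeArakelov
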